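/-
Copyright (c) 2026 the pub-hodgecm-mathlib formalisation cell (harness21).  Prover seat hodgecm-mathlib-K2E3-p12 (g5) (E3 §L lead on loan to E1), Track B ∕ K2-LIT,
h413 = `stmt-HodgeConjecture-24833`, line `K2_E1_TraceFormulaBeta`, campaign «EIS-WHITTAKER-2», rider (r1) of the dealer K2E1-plan (g4) 2026-09-04T07:06:03Z:
THE CONSTANT TERM (`ξ = 0`) OF THE ARCHIMEDEAN WHITTAKER TRANSFORM — `∫_ℝ (1 + c s²)^{−z} ds = √(π∕c)·Γ(z − ½)∕Γ(z)`.
-/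
import Summits.HodgeConjecture.HodgeConjecture.Theorems.K2E1ArchWhittakerContinuation   -- ★ p858148 (this seat): §3 `integral_onePlusSqPow_mul_phase_eq`
import HarnessLib

/-!
# K2·E1 — `K2E1ArchWhittakerConstantTerm`: `∫_ℝ (1 + c s²)^{−z} ds = √(π∕c) · Γ(z − ½) ∕ Γ(z)`  (`Re z > ½`, `c > 0`)

Track B ∕ K2-LIT, crux h413 = `stmt-HodgeConjecture-24833`, route of record `HCCMUnconditional`; cell `hodgecm-mathlib`, squad K2, ENGINE E1 (campaign «EIS-WHITTAKER-2»,
rider (r1)).  Prover seat `hodgecm-mathlib-K2E3-p12` (g5) on loan.  THEOREMS ONLY (no `def`, no `instance`, no notation, no named-fact hypothesis, no `sorry`);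
lane `--supports stmt-HodgeConjecture-24833 --as helper` (count-neutral).  Closes no socket.

THE MATHEMATICS [Bump1997, §1.6 (1.25); Garrett2018, §1.9].  At `ξ = 0` the Whittaker transform ★ p858148 §3 is the archimedean factor `c_∞(z)` of the intertwining
scalar: `∫_ℝ (1 + c s²)^{−z} ds = Γ(z)⁻¹·√(π∕c)·∫_0^∞ t^{z−3∕2} e^{−t} dt = √(π∕c)·Γ(z − ½)∕Γ(z)` (Euler's integral at `z − ½`, `Re z > ½`).  Consumers: K2E2-p12 (g4)
«R7₂-SCALAR» FILE 3 (`c_∞`), K2E1-p08 (g5) (a3)₃-(E) scaling.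
* `integral_cpow_mul_exp_neg_eq_Gamma` — `∫_0^∞ t^{z−3∕2} e^{−t} dt = Γ(z − ½)` in the kernel currency of ★ p858148;
* **`integral_onePlusSqPow_eq`** — the displayed formula.
SAT-WITNESS (ruling «VAC-U» (3)): nothing quantified over a structure; at `z = 1`, `c = 1`: `∫ (1+s²)⁻¹ ds = √π·Γ(½)∕Γ(1) = π` ✓.
HONEST LABEL: HC_CM is proved only modulo the 7 printed citations (2 remaining named inputs: hLiu418 = `stmt-HodgeConjecture-24832`, h413 = `stmt-HodgeConjecture-24833`)
until rung 0 closes; this file asserts no named fact and closes no socket.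
References: [Bump1997] §1.6 (1.25) · [Garrett2018] §1.9.
-/

set_option autoImplicit false
-- the mandated namespace repeats the single-problem summit's segment (`HodgeConjecture.HodgeConjecture`)
set_option linter.dupNamespace false

noncomputable section

open MeasureTheory Filter Topology Set Real
open Summit.HodgeConjecture.HodgeConjecture.Cruxes.H413.K2E1ArchWhittakerContinuation (integral_onePlusSqPow_mul_phase_eq)

namespace Summit.HodgeConjecture.HodgeConjecture.Cruxes.H413.K2E1ArchWhittakerConstantTerm

/-- Euler's integral in the kernel currency of ★ p858148: `∫_0^∞ t^{z−3∕2} e^{−t} dt = Γ(z − ½)` for `Re z > ½`. [cite: Bump1997, §1.6 (1.25)] -/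
theorem integral_cpow_mul_exp_neg_eq_Gamma {z : ℂ} (hz : 1 / 2 < z.re) :
    ∫ t in Ioi (0 : ℝ), (t : ℂ) ^ (z - 3 / 2) * Complex.exp (-(t : ℂ)) = Complex.Gamma (z - 1 / 2) := by
  have hz' : 0 < (z - 1 / 2).re := by
    rw [Complex.sub_re, show (1 / 2 : ℂ).re = 1 / 2 by norm_num]; linarith
  rw [Complex.Gamma_eq_integral hz', Complex.GammaIntegral]
  refine setIntegral_congr_fun measurableSet_Ioi fun t _ => ?_
  rw [show z - 1 / 2 - 1 = z - 3 / 2 by ring, Complex.ofReal_exp, Complex.ofReal_neg, mul_comm]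

/-- **THE CONSTANT TERM OF THE ARCHIMEDEAN WHITTAKER TRANSFORM**: `∫_ℝ (1 + c s²)^{−z} ds = √(π∕c) · Γ(z − ½) ∕ Γ(z)` for `Re z > ½`, `c > 0` (★ p858148 §3 at `ξ = 0`,
then Euler's integral at `z − ½`). [cite: Bump1997, §1.6 (1.25)] [cite: Garrett2018, §1.9] -/
theorem integral_onePlusSqPow_eq {z : ℂ} (hz : 1 / 2 < z.re) {c : ℝ} (hc : 0 < c) :
    ∫ s : ℝ, (((1 + c * s ^ 2 : ℝ)) : ℂ) ^ (-z) = ((Real.sqrt (π / c) : ℝ) : ℂ) * Complex.Gamma (z - 1 / 2) / Complex.Gamma z := by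
  have h := integral_onePlusSqPow_mul_phase_eq hz hc 0
  have hL : ∀ s : ℝ, (((1 + c * s ^ 2 : ℝ)) : ℂ) ^ (-z) * Complex.exp (-(2 * π * Complex.I * (0 : ℝ) * s)) = (((1 + c * s ^ 2 : ℝ)) : ℂ) ^ (-z) := by
    intro s; simp
  have hR : ∀ t : ℝ, (t : ℂ) ^ (z - 3 / 2) * Complex.exp (-(t : ℂ) - ((π ^ 2 * (0 : ℝ) ^ 2 / c : ℝ) : ℂ) / (t : ℂ)) =
      (t : ℂ) ^ (z - 3 / 2) * Complex.exp (-(t : ℂ)) := by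
    intro t; simp
  simp_rw [hL, hR, integral_cpow_mul_exp_neg_eq_Gamma hz] at h
  rw [h]
  ring

end Summit.HodgeConjecture.HodgeConjecture.Cruxes.H413.K2E1ArchWhittakerConstantTerm

end
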